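import Summits.CriticalPhenomena.SAWScalingLimit.Theses.SAWEdwardsStrongCoupling
import Literature.Probability.RandomPlanarGeometry.WeaklySAW

/-!
# Birth skeleton (`Lines/birth.lean`, BC3) for the crux `StrongCouplingLimit`
(item stmt-CriticalPhenomena-4650, rank 3 of route `SAWEdwardsStrongCoupling`, sub-problem `SAWScalingLimit`)

Crux (FIXED, by name): `Summit.CriticalPhenomena.SAWScalingLimit.Theses.SAWEdwardsStrongCoupling.StrongCouplingLimit`
— for every EDWARDS-WINDOW LIMIT FAMILY `Q` (for each `g > 0`, `Q g` is chordal and `Q g D` is the weak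
limit as `δ → 0⁺` of the critical Domb–Joyce chordal laws `WL_{min 1 (g δ²)}(Ω_δ; a_δ, b_δ)` for every
endpoint approximation), there is a chordal family `P` with the two-sided restriction property
(`ChordalFamily.IsRestriction`, product form), carried by simple curves meeting `∂D` only at the marked
points, such that `Q g D → P D` weakly as `g → ∞` on every approximable Dobrushin domain.

## The line = the route's own TWO-LAYER PLAN, typed, with the restriction passage cut at its seam

Route header: "StrongCouplingLimit ⇐ TiltedExcursionTight → LimitRestrictionSimple"; informal tools:
"exact restriction at every g (lattice identity passed to the window limit), excursion/annulus estimates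
uniform in g, monotone exponential-family structure g ↦ Q_g". Typed here as FIVE registered stubs over
TREE declarations only (the inlined law `WL` of the route items is the tree definition
`Literature.Probability.RandomPlanarGeometry.WeaklySAW.domainLaw`, definitionally — `WeaklySAW.domainLaw_def`
is `rfl` — so every stub is stated with `WeaklySAW.domainLaw` and the crux is recovered BY NAME through
`strongCouplingLimit_iff : StrongCouplingLimit ↔ … := Iff.rfl`):

* S1 `stub_windowRestriction` (L; "exact restriction at every g") — every Edwards-window limit family has,
  at every finite coupling `g > 0`, the two-sided restriction property: the Domb–Joyce weight
  `μ_λ^{-|p|} ∏_{s<t}(1 - λ𝟙{p_s = p_t})` is path-intrinsic and graph-independent, so at lattice level the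
  law in `Ω'_δ ≤ Ω_δ` IS the law in `Ω_δ` conditioned on using only edges of `Ω'_δ` (the SAW identity of
  LSW04 §3.4.5, verbatim for the weakly self-avoiding walk); the passage `δ → 0⁺` at FIXED `g` is the
  window analogue of the sibling crux `RestrictionOfLimit` (its registered line `Cruxes/RestrictionOfLimit/
  Lines/birth.lean`: lattice identity → domination → no loss of avoidance mass), in the regime where the
  limit is equivalent to the Brownian excursion (barrier `PlanarEdwardsModelDiffusive`, used not fought:
  Brownian touching of `∂D' ∩ D` without crossing is null, so the closed avoidance event carries no extra
  mass).
* S2 `stub_strongCouplingConvergence` (XL, open; "TiltedExcursionTight" + uniqueness of the limit) — the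
  `g → ∞` limit EXISTS: a chordal family `P` with `Q g D → P D` weakly (bounded continuous test functions)
  on every approximable Dobrushin domain (every Dobrushin domain is approximable:
  `SAW.exists_isEndpointApprox`, PROVED in `SAWScalingLimitFamily.lean`, so `P` is pinned down). Tightness
  uniform in `g` (annulus-crossing bounds for tilted excursions, KS Condition G2 type) plus identification
  of subsequential limits (monotone exponential-family structure in `g`).
* S3 `stub_avoidanceDomination` (M–L; PROVABLE NOW, model-blind) — the SOFT half of "restriction passes to
  the strong-coupling limit": if `Q g` is chordal with restriction for `g > 0`, `P` is chordal and
  `Q g D → P D` on approximable domains, then for `D' ⊆ D` with the same marked points and Borel `T`,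
  `c · P D'(T) ≤ P D(T ∩ R)` with `R = {γ ⊆ cl D'}` (`CurveClass.rangeSubset (closure D'.carrier)`, closed)
  and `c = liminf_{g → ∞} Q g D (R)`. Proof plan: restriction at `g` gives `Q g D(U ∩ R) = Q g D'(U)·Q g D(R)`;
  portmanteau for `Q g D' ⇒ P D'` on open `U` and for `Q g D ⇒ P D` on the closed `cl U ∩ R`
  (`ENNReal` liminf of a product ≥ product of liminfs); shrink `1/n`-thickenings onto closed `F`; inner
  regularity (closed sets) of the finite Borel measure `c · P D'` on the metric space `CurveClass ℂ`.
* S4 `stub_noAvoidanceLoss` (XL, open; the HARD half) — NO LOSS OF AVOIDANCE MASS AT STRONG COUPLING: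
  `P D(R) ≤ liminf_{g → ∞} Q g D(R)`. With the free bound `limsup ≤ P D(R)` (closed event) this is
  `Q g D{γ ⊆ cl D'} → P D{γ ⊆ cl D'}`: the window excursions that leave `cl D'` by a vanishing amount carry,
  UNIFORMLY IN `g`, vanishing mass — a near-boundary estimate uniform in the coupling (the crux's recorded
  why-might-fail "annulus-crossing bounds uniform in g" lives here and in S2, by name). Finite-`g`
  restriction (S1's conclusion) is threaded as a hypothesis (the tool: compare `Q g D(R_{D'_ε}) - Q g D(R_{D'})`
  across an `ε`-enlargement through the restriction identity).
* S5 `stub_limitSimple` (XL, open; "LimitRestrictionSimple", simplicity half) — the strong-coupling limit is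
  carried by SIMPLE curves meeting `∂D` only at `a`, `b` ('the excursion that has paid, at the critical
  price, for every self-intersection' has no double points and no boundary excursions in the limit:
  sub- and super-multiplicativity of bridge-type decompositions uniform in `g`, KemppainenSmirnov2017 Thm 1.5
  type a-priori bounds, DuminilCopinHammond2013-type non-stickiness).

`StrongCouplingLimit_of` (kernel-checked, NO `sorry` of its own, ≈ 40 lines) is a genuine assembly, not a
one-line seam: `P` from S2; simplicity from S5; restriction by the `ℝ≥0∞` SQUEEZE of the sibling line
`RestrictionOfLimit/Lines/birth.lean` run in `g` instead of `δ` — S3 at `T = univ` gives `c ≤ P D(R)`, S4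
gives `P D(R) ≤ c`, so `c = P D(R)`; S3 at `T` and at `Tᶜ`, whose two sides both sum to `c`, forces
`P D'(T) · P D(R) = P D(T ∩ R)` termwise by finiteness — which is `ChordalFamily.IsRestriction` verbatim.

What the cut buys and what it bets. S3 is provable now and S1 is the fixed-`g` (diffusive-regime) copy of a
sibling crux with a registered line; ALL the strong-coupling difficulty sits, by name, in S2 (existence),
S4 (one inequality between a continuum avoidance probability and a liminf of window avoidance
probabilities) and S5 (simplicity). The cut is SUFFICIENT, not an equivalence: S4 is slightly more than the
crux literally needs on sub-domains pinched at a marked point (where both sides are expected to vanish).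

Disproof used: none relevant — no `Disproof.lean` / `_false_without_` theorem exists for this crux
(`ledger crux ls stmt-CriticalPhenomena-4650`: no workfiles before this one, 2026-08-17). Negatives index
(11 entries, 2026-08-17): none is a strong-coupling / passage-to-the-limit statement; the refuted ALL-`δ`
tightness stmt-CriticalPhenomena-0772 is not approached — no tightness clause is registered, every limit
is along `Filter.atTop` in `g` or inside the crux's own `TendstoLaw` along `𝓝[>] 0`.
Evidence read: refuter rreview 02360353 (W1.lean: rc0, conditional on a window family, no cex conceivable),
grounder g15-10 (NEW/OPEN; MadrasSlade1993 §10.1, denHollander2009 §4.8(4)).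

Sources: MadrasSlade1993 §10.1 (held pp. 377–378); denHollander2009 §4.8 Challenge (4); Stoll1989;
LawlerSchrammWerner2003Restriction (arXiv:math/0209343) Thm 6.1, Cor. 8.6; LawlerSchrammWerner2004SAW
(arXiv:math/0204277) §3.4.5 p. 14 (lattice restriction), Prediction 1; KemppainenSmirnov2017 Thm 1.5;
DuminilCopinHammond2013; BDGS2012 §1.2 (1.4)–(1.9), §1.3 (1.12); Literature.Barriers.CriticalPhenomena.
PlanarEdwardsModelDiffusive; sibling line `Cruxes/RestrictionOfLimit/Lines/birth.lean` (stmt-CriticalPhenomena-0773).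
-/

noncomputable section

open MeasureTheory Filter Topology Set
open scoped ENNReal
open Literature.Probability.RandomPlanarGeometry Literature.Probability.LatticeModels
open Summit.CriticalPhenomena.SAWScalingLimit.Theses.SAWEdwardsStrongCoupling (StrongCouplingLimit)

namespace Summit.CriticalPhenomena.SAWScalingLimit.Cruxes.StrongCouplingLimit.Birth

/-! ### Vocabulary of the line (named; every stub below restates it literally over tree declarations) -/

/-- **`Q` is an Edwards-window limit family** — the hypothesis of the crux, with the inlined law `WL`
written as the tree definition `WeaklySAW.domainLaw` (definitionally the same term,
`WeaklySAW.domainLaw_def`): for every `g > 0`, `Q g` is chordal and, for every Dobrushin domain and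
every endpoint approximation, the critical Domb–Joyce chordal law with coupling `λ = min 1 (g δ²)` in
`(Ω_δ; a_δ, b_δ)` converges weakly to `Q g D` as `δ → 0⁺`. -/
def IsWindowLimitFamily (Q : ℝ → ChordalFamily) : Prop :=
  ∀ g : ℝ, 0 < g → (Q g).IsChordal ∧
    ∀ (D : DobrushinDomain) (a b : ℝ → Site 2), SAW.IsEndpointApprox D a b →
      TendstoLaw (fun (_ : ℝ) (x : CurveClass ℂ) => x)
        (fun δ => WeaklySAW.domainLaw (min 1 (g * δ ^ 2)) D.carrier δ (a δ) (b δ)) id (Q g D)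

/-- **`P` is a strong-coupling limit of `Q`** — the convergence clause of the crux: on every
approximable Dobrushin domain, `Q g D → P D` weakly as `g → ∞` (bounded continuous test functions). -/
def IsStrongCouplingLimitOf (Q : ℝ → ChordalFamily) (P : ChordalFamily) : Prop :=
  ∀ (D : DobrushinDomain) (a b : ℝ → Site 2), SAW.IsEndpointApprox D a b →
    ∀ f : BoundedContinuousFunction (CurveClass ℂ) ℝ,
      Tendsto (fun g : ℝ => ∫ x, f x ∂(Q g D)) atTop (𝓝 (∫ x, f x ∂(P D)))

/-- The simplicity clause of the crux: `P` is carried by simple curves meeting `∂D` only at `a`, `b`. -/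
def IsSimpleBoundaryAvoiding (P : ChordalFamily) : Prop :=
  ∀ D : DobrushinDomain, ∀ᵐ γ ∂(P D),
    γ ∈ CurveClass.simple ∧ γ.range ∩ frontier D.carrier ⊆ {D.pt 0, D.pt 1}

/-- **S1, named.** Exact restriction at every finite coupling. -/
def WindowRestriction : Prop :=
  ∀ Q : ℝ → ChordalFamily, IsWindowLimitFamily Q → ∀ g : ℝ, 0 < g → (Q g).IsRestriction

/-- **S2, named.** Existence of the strong-coupling limit as a chordal family. -/
def StrongCouplingConvergence : Prop :=
  ∀ Q : ℝ → ChordalFamily, IsWindowLimitFamily Q →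
    ∃ P : ChordalFamily, P.IsChordal ∧ IsStrongCouplingLimitOf Q P

/-- **S3, named.** Domination (soft half of the restriction passage `g → ∞`). -/
def AvoidanceDomination : Prop :=
  ∀ (Q : ℝ → ChordalFamily) (P : ChordalFamily),
    (∀ g : ℝ, 0 < g → (Q g).IsChordal ∧ (Q g).IsRestriction) → P.IsChordal →
      IsStrongCouplingLimitOf Q P →
        ∀ (D D' : DobrushinDomain), D'.carrier ⊆ D.carrier → D'.pt 0 = D.pt 0 → D'.pt 1 = D.pt 1 →
          ∀ T : Set (CurveClass ℂ), MeasurableSet T →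
            Filter.liminf (fun g : ℝ => Q g D (CurveClass.rangeSubset (closure D'.carrier))) atTop *
                P D' T ≤
              P D (T ∩ CurveClass.rangeSubset (closure D'.carrier))

/-- **S4, named.** No loss of avoidance mass at strong coupling (hard half). -/
def NoAvoidanceLoss : Prop :=
  ∀ (Q : ℝ → ChordalFamily) (P : ChordalFamily), IsWindowLimitFamily Q →
    (∀ g : ℝ, 0 < g → (Q g).IsRestriction) → P.IsChordal → IsStrongCouplingLimitOf Q P →
      ∀ (D D' : DobrushinDomain), D'.carrier ⊆ D.carrier → D'.pt 0 = D.pt 0 → D'.pt 1 = D.pt 1 →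
        P D (CurveClass.rangeSubset (closure D'.carrier)) ≤
          Filter.liminf (fun g : ℝ => Q g D (CurveClass.rangeSubset (closure D'.carrier))) atTop

/-- **S5, named.** The strong-coupling limit is carried by simple, boundary-avoiding curves. -/
def LimitSimple : Prop :=
  ∀ (Q : ℝ → ChordalFamily) (P : ChordalFamily), IsWindowLimitFamily Q → P.IsChordal →
    IsStrongCouplingLimitOf Q P → IsSimpleBoundaryAvoiding P

/-! ### The crux over the named vocabulary — DEFINITIONALLY the route decl -/

/-- The route decl `StrongCouplingLimit` (whose items inline the law `WL` as a `let`) is, by `Iff.rfl`,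
the statement over `WeaklySAW.domainLaw`: `WL λ Ω δ a b` and `WeaklySAW.domainLaw λ Ω δ a b` are the
same term after unfolding (`WeaklySAW.domainLaw_def`, `walkWeight`, `weaklyConnectiveConstant`). -/
theorem strongCouplingLimit_iff :
    StrongCouplingLimit ↔
      ∀ Q : ℝ → ChordalFamily, IsWindowLimitFamily Q →
        ∃ P : ChordalFamily, P.IsChordal ∧ P.IsRestriction ∧ IsSimpleBoundaryAvoiding P ∧
          IsStrongCouplingLimitOf Q P :=
  Iff.rfl

/-! ### The stubs (the ONLY `sorry`s of this file)

Each stub is stated over TREE VOCABULARY ONLY (the named statements above, unfolded by hand), so that it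
lands verbatim as a `Theorems/SAWEdwardsStrongCouplingStrongCouplingLimit<Stub>.lean` file
`--supports stmt-CriticalPhenomena-4650` without importing this workfile; the `*_holds` theorems below
certify definitionally that the unfolded text IS the named statement. Provers landing a stub need
`import Literature.Probability.RandomPlanarGeometry.WeaklySAW` (fact-free) and
`open MeasureTheory Filter Topology Set Literature.Probability.RandomPlanarGeometry Literature.Probability.LatticeModels`
for the registered signature text to elaborate verbatim. -/

/-- **S1 — exact restriction at every finite coupling** (L). For every Edwards-window limit family `Q`
and every `g > 0`, `Q g` has the two-sided restriction property (product form): the Domb–Joyce weight is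
path-intrinsic, so the critical weakly-SAW law of `Ω'_δ ≤ Ω_δ` is the law of `Ω_δ` conditioned on using
only edges of `Ω'_δ` (LSW04 arXiv:math/0204277 p. 14 §3.4.5, verbatim for the weakly self-avoiding walk),
and at FIXED `g` (diffusive window, limit equivalent to the Brownian excursion) the closed avoidance event
gains no mass as `δ → 0⁺`. The window copy of the sibling crux `RestrictionOfLimit` (stmt-0773). -/
theorem stub_windowRestriction :
    ∀ Q : ℝ → ChordalFamily,
      (∀ g : ℝ, 0 < g → (Q g).IsChordal ∧
        ∀ (D : DobrushinDomain) (a b : ℝ → Site 2), SAW.IsEndpointApprox D a b →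
          TendstoLaw (fun (_ : ℝ) (x : CurveClass ℂ) => x)
            (fun δ => WeaklySAW.domainLaw (min 1 (g * δ ^ 2)) D.carrier δ (a δ) (b δ)) id (Q g D)) →
      ∀ g : ℝ, 0 < g → (Q g).IsRestriction := by
  sorry

/-- **S2 — existence of the strong-coupling limit** (XL, open; MadrasSlade1993 §10.1, denHollander2009
§4.8 Challenge (4)). For every Edwards-window limit family `Q` there is a chordal family `P` with
`Q g D → P D` weakly as `g → ∞` on every approximable Dobrushin domain: tightness of the critical tilted
excursions uniform in `g` plus uniqueness of subsequential limits. -/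
theorem stub_strongCouplingConvergence :
    ∀ Q : ℝ → ChordalFamily,
      (∀ g : ℝ, 0 < g → (Q g).IsChordal ∧
        ∀ (D : DobrushinDomain) (a b : ℝ → Site 2), SAW.IsEndpointApprox D a b →
          TendstoLaw (fun (_ : ℝ) (x : CurveClass ℂ) => x)
            (fun δ => WeaklySAW.domainLaw (min 1 (g * δ ^ 2)) D.carrier δ (a δ) (b δ)) id (Q g D)) →
      ∃ P : ChordalFamily, P.IsChordal ∧
        ∀ (D : DobrushinDomain) (a b : ℝ → Site 2), SAW.IsEndpointApprox D a b →
          ∀ f : BoundedContinuousFunction (CurveClass ℂ) ℝ,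
            Tendsto (fun g : ℝ => ∫ x, f x ∂(Q g D)) atTop (𝓝 (∫ x, f x ∂(P D))) := by
  sorry

/-- **S3 — domination, the soft half of the restriction passage** (M–L, provable now, model-blind).
If `Q g` is chordal with restriction for every `g > 0`, `P` is chordal and `Q g D → P D` weakly as
`g → ∞` on every approximable Dobrushin domain (all of them: `SAW.exists_isEndpointApprox`), then for
`D' ⊆ D` with the same marked points and every Borel `T`,
`liminf_{g→∞} Q g D {γ ⊆ cl D'} · P D'(T) ≤ P D (T ∩ {γ ⊆ cl D'})`. Portmanteau twice (open `U` under
`Q g D' ⇒ P D'`, closed `cl U ∩ {γ ⊆ cl D'}` under `Q g D ⇒ P D`), thickenings, inner regularity. -/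
theorem stub_avoidanceDomination :
    ∀ (Q : ℝ → ChordalFamily) (P : ChordalFamily),
      (∀ g : ℝ, 0 < g → (Q g).IsChordal ∧ (Q g).IsRestriction) → P.IsChordal →
        (∀ (D : DobrushinDomain) (a b : ℝ → Site 2), SAW.IsEndpointApprox D a b →
          ∀ f : BoundedContinuousFunction (CurveClass ℂ) ℝ,
            Tendsto (fun g : ℝ => ∫ x, f x ∂(Q g D)) atTop (𝓝 (∫ x, f x ∂(P D)))) →
          ∀ (D D' : DobrushinDomain), D'.carrier ⊆ D.carrier → D'.pt 0 = D.pt 0 → D'.pt 1 = D.pt 1 →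
            ∀ T : Set (CurveClass ℂ), MeasurableSet T →
              Filter.liminf (fun g : ℝ => Q g D (CurveClass.rangeSubset (closure D'.carrier))) atTop *
                  P D' T ≤
                P D (T ∩ CurveClass.rangeSubset (closure D'.carrier)) := by
  sorry

/-- **S4 (hard) — no loss of avoidance mass at strong coupling** (XL, open). For every Edwards-window
limit family `Q` with restriction at every finite coupling, every chordal strong-coupling limit `P` of
`Q`, and `D' ⊆ D` with the same marked points: `P D {γ ⊆ cl D'} ≤ liminf_{g→∞} Q g D {γ ⊆ cl D'}` — the
tilted excursions leaving `cl D'` by a vanishing amount have vanishing mass UNIFORMLY in `g`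
(near-boundary / annulus estimates uniform in the coupling; LawlerSchrammWerner2003Restriction Thm 6.1,
Cor. 8.6 for the expected limit, KemppainenSmirnov2017 Condition G2 type inputs). -/
theorem stub_noAvoidanceLoss :
    ∀ (Q : ℝ → ChordalFamily) (P : ChordalFamily),
      (∀ g : ℝ, 0 < g → (Q g).IsChordal ∧
        ∀ (D : DobrushinDomain) (a b : ℝ → Site 2), SAW.IsEndpointApprox D a b →
          TendstoLaw (fun (_ : ℝ) (x : CurveClass ℂ) => x)
            (fun δ => WeaklySAW.domainLaw (min 1 (g * δ ^ 2)) D.carrier δ (a δ) (b δ)) id (Q g D)) →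
      (∀ g : ℝ, 0 < g → (Q g).IsRestriction) → P.IsChordal →
        (∀ (D : DobrushinDomain) (a b : ℝ → Site 2), SAW.IsEndpointApprox D a b →
          ∀ f : BoundedContinuousFunction (CurveClass ℂ) ℝ,
            Tendsto (fun g : ℝ => ∫ x, f x ∂(Q g D)) atTop (𝓝 (∫ x, f x ∂(P D)))) →
          ∀ (D D' : DobrushinDomain), D'.carrier ⊆ D.carrier → D'.pt 0 = D.pt 0 → D'.pt 1 = D.pt 1 →
            P D (CurveClass.rangeSubset (closure D'.carrier)) ≤
              Filter.liminf (fun g : ℝ => Q g D (CurveClass.rangeSubset (closure D'.carrier)))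
                atTop := by
  sorry

/-- **S5 — the strong-coupling limit is simple and boundary-avoiding** (XL, open). For every
Edwards-window limit family `Q` and every chordal strong-coupling limit `P` of `Q`, each `P D` is carried
by simple curves meeting `∂D` only at the marked points (KemppainenSmirnov2017 Thm 1.5-type a-priori
bounds uniform in `g`; DuminilCopinHammond2013-type non-stickiness; LawlerSchrammWerner2003Restriction
Cor. 8.6 for the expected limit). -/
theorem stub_limitSimple :
    ∀ (Q : ℝ → ChordalFamily) (P : ChordalFamily),
      (∀ g : ℝ, 0 < g → (Q g).IsChordal ∧
        ∀ (D : DobrushinDomain) (a b : ℝ → Site 2), SAW.IsEndpointApprox D a b →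
          TendstoLaw (fun (_ : ℝ) (x : CurveClass ℂ) => x)
            (fun δ => WeaklySAW.domainLaw (min 1 (g * δ ^ 2)) D.carrier δ (a δ) (b δ)) id (Q g D)) →
      P.IsChordal →
        (∀ (D : DobrushinDomain) (a b : ℝ → Site 2), SAW.IsEndpointApprox D a b →
          ∀ f : BoundedContinuousFunction (CurveClass ℂ) ℝ,
            Tendsto (fun g : ℝ => ∫ x, f x ∂(Q g D)) atTop (𝓝 (∫ x, f x ∂(P D)))) →
          ∀ D : DobrushinDomain, ∀ᵐ γ ∂(P D),
            γ ∈ CurveClass.simple ∧ γ.range ∩ frontier D.carrier ⊆ {D.pt 0, D.pt 1} := by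
  sorry

/-! ### Consistency: each named statement IS its registered stub (definitionally) -/

theorem windowRestriction_holds : WindowRestriction := stub_windowRestriction
theorem strongCouplingConvergence_holds : StrongCouplingConvergence := stub_strongCouplingConvergence
theorem avoidanceDomination_holds : AvoidanceDomination := stub_avoidanceDomination
theorem noAvoidanceLoss_holds : NoAvoidanceLoss := stub_noAvoidanceLoss
theorem limitSimple_holds : LimitSimple := stub_limitSimple

/-! ### Name-keyed aliases of the five statements — the hypotheses of `StrongCouplingLimit_of`

The native skeleton audit (`#h21_check_skeleton`) admits a hypothesis of the skeleton theorem only if its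
head constant is a registered obligation or is NAMED like a declared stub; `__Registered.stub_X` is the
statement of `stub_X` under that name (device of `Cruxes/RestrictionOfLimit/Lines/birth.lean`; the `__`
namespace is an implementation detail, so the audit's stub report resolves each `stub_…` to the sorried
theorem, not to the alias). Each alias is `rfl`-equal to its statement. -/
namespace __Registered

/-- Alias of `WindowRestriction` keyed by the registered stub name. -/
abbrev stub_windowRestriction : Prop := WindowRestriction
/-- Alias of `StrongCouplingConvergence` keyed by the registered stub name. -/
abbrev stub_strongCouplingConvergence : Prop := StrongCouplingConvergence
/-- Alias of `AvoidanceDomination` keyed by the registered stub name. -/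
abbrev stub_avoidanceDomination : Prop := AvoidanceDomination
/-- Alias of `NoAvoidanceLoss` keyed by the registered stub name. -/
abbrev stub_noAvoidanceLoss : Prop := NoAvoidanceLoss
/-- Alias of `LimitSimple` keyed by the registered stub name. -/
abbrev stub_limitSimple : Prop := LimitSimple

end __Registered

/-! ### The skeleton theorem: the five stubs imply the crux, BY NAME -/

/-- An `ℝ≥0∞` squeeze: if `a ≤ A`, `b ≤ B`, the sums agree and `b` is finite, then `a = A`. -/
theorem eq_of_add_eq_add_of_le {a A b B : ℝ≥0∞} (ha : a ≤ A) (hb : b ≤ B) (hs : a + b = A + B)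
    (hbt : b ≠ ∞) : a = A := by
  refine le_antisymm ha ?_
  have h : A + b ≤ a + b := by
    calc A + b ≤ A + B := add_le_add le_rfl hb
      _ = a + b := hs.symm
  exact (ENNReal.add_le_add_iff_right hbt).1 h

/-- **`StrongCouplingLimit` from the line `birth`** (kernel-checked, no `sorry` of its own): for an
Edwards-window family `Q`, S2 gives the chordal strong-coupling limit `P`; S5 gives simplicity and
boundary avoidance; S1 gives restriction of every `Q g`, `g > 0`; then for `D' ⊆ D` with the same marked
points and `c = liminf_g Q g D {γ ⊆ cl D'}`, S3 at `univ` and S4 squeeze `c = P D {γ ⊆ cl D'}`, and S3 at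
`T` and at `Tᶜ`, whose two sides both sum to `c`, forces `P D'(T) · P D {γ ⊆ cl D'} = P D (T ∩ {γ ⊆ cl D'})`
by finiteness — `ChordalFamily.IsRestriction` verbatim. Hypotheses = the five stubs, under their
registered names; conclusion = the route decl, by name. -/
theorem StrongCouplingLimit_of (hW : __Registered.stub_windowRestriction)
    (hS : __Registered.stub_strongCouplingConvergence) (hA : __Registered.stub_avoidanceDomination)
    (hN : __Registered.stub_noAvoidanceLoss) (hL : __Registered.stub_limitSimple) :
    Summit.CriticalPhenomena.SAWScalingLimit.Theses.SAWEdwardsStrongCoupling.StrongCouplingLimit := by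
  refine strongCouplingLimit_iff.2 fun Q hQ => ?_
  -- the strong-coupling limit `P` (S2), restriction of every `Q g` (S1)
  obtain ⟨P, hPch, hconv⟩ := hS Q hQ
  have hQres : ∀ g : ℝ, 0 < g → (Q g).IsRestriction := hW Q hQ
  have hQcr : ∀ g : ℝ, 0 < g → (Q g).IsChordal ∧ (Q g).IsRestriction :=
    fun g hg => ⟨(hQ g hg).1, hQres g hg⟩
  refine ⟨P, hPch, ?_, hL Q P hQ hPch hconv, hconv⟩
  -- restriction of the limit: the squeeze
  intro D D' hsub h0 h1 T hT
  haveI : IsProbabilityMeasure (P D') := (hPch D').1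
  haveI : IsProbabilityMeasure (P D) := (hPch D).1
  -- the asymptotic window avoidance mass `c`
  generalize hc : Filter.liminf
      (fun g : ℝ => Q g D (CurveClass.rangeSubset (closure D'.carrier))) atTop = c at *
  have hdom : ∀ S : Set (CurveClass ℂ), MeasurableSet S →
      c * P D' S ≤ P D (S ∩ CurveClass.rangeSubset (closure D'.carrier)) := by
    intro S hS'
    have := hA Q P hQcr hPch hconv D D' hsub h0 h1 S hS'
    rwa [hc] at this
  have hloss : P D (CurveClass.rangeSubset (closure D'.carrier)) ≤ c := by
    have := hN Q P hQ hQres hPch hconv D D' hsub h0 h1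
    rwa [hc] at this
  -- abbreviations
  set μ := P D with hμ
  set ν := P D' with hν
  set R := CurveClass.rangeSubset (closure D'.carrier) with hR
  -- `c = μ R`
  have hc_le : c ≤ μ R := by simpa [measure_univ] using hdom Set.univ MeasurableSet.univ
  have hc_eq : c = μ R := le_antisymm hc_le hloss
  -- the squeeze on `T` and `Tᶜ`
  have hT1 : c * ν T ≤ μ (T ∩ R) := hdom T hT
  have hT2 : c * ν Tᶜ ≤ μ (Tᶜ ∩ R) := hdom Tᶜ hT.compl
  have hsumν : c * ν T + c * ν Tᶜ = c := by
    rw [← mul_add, measure_add_measure_compl hT, measure_univ, mul_one]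
  have hsumμ : μ (T ∩ R) + μ (Tᶜ ∩ R) = μ R := by
    rw [Set.inter_comm T R, Set.inter_comm Tᶜ R]
    exact measure_inter_add_sdiff₀ R hT.nullMeasurableSet
  have hfin : c * ν Tᶜ ≠ ∞ :=
    ne_top_of_le_ne_top (measure_ne_top μ _) hT2
  have hsum : c * ν T + c * ν Tᶜ = μ (T ∩ R) + μ (Tᶜ ∩ R) := by rw [hsumν, hsumμ, hc_eq]
  have key : c * ν T = μ (T ∩ R) := eq_of_add_eq_add_of_le hT1 hT2 hsum hfin
  -- conclude: `ν T * μ R = μ (T ∩ R)`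
  rw [← hc_eq, mul_comm]
  exact key

/-- Wiring check (an `example`, so that `StrongCouplingLimit_of` stays the only theorem concluding the
crux): the registered stubs, with their tree-vocabulary types, feed the skeleton theorem as stated — this
term becomes the crux proof when the five `sorry`s above are discharged. -/
example : Summit.CriticalPhenomena.SAWScalingLimit.Theses.SAWEdwardsStrongCoupling.StrongCouplingLimit :=
  StrongCouplingLimit_of stub_windowRestriction stub_strongCouplingConvergence stub_avoidanceDomination
    stub_noAvoidanceLoss stub_limitSimple

end Summit.CriticalPhenomena.SAWScalingLimit.Cruxes.StrongCouplingLimit.Birth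

end
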